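import Literature.Probability.Percolation.ZdFourArmOutLanded
import Literature.Probability.Percolation.ZdFourArmSepInitProb
import Literature.Probability.Percolation.ZdFourArmSeparationStep
import Literature.Probability.Percolation.ZdFourArmQuasiMultOfSeparation
import HarnessLib

/-!
# Kesten's arm separation for four arms of bond percolation on `ℤ²`: the internal multi-scale scheme

Topic `Literature/Probability/Percolation`; critical bond percolation on `ℤ²`
(`P = P_{1/2} = bondPercolation (zdGraph 2) half`). PROOFS ONLY (no definition, no named fact).

The INTERNAL half of Kesten's arm-separation theorem (H. Kesten, CMP 109 (1987), §2, Lemma 5;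
P. Nolin, EJP 13 (2008), §4.4, proof of Thm. 11, "2. Internal extremities" [arXiv 0711.4948: Thm. 10,
p. 13]: "the reasoning is the same … from `∂S_{2^k}` toward the interior … The extremities on the
internal boundary are now well-separated too") run SECOND, i.e. on the outer-landed event
`zdFourArmOutLanded` (`ZdFourArmOutLanded.lean`) and ending in the well-separated event `zdFourArmSep`
(`ZdFourArmSeparated.lean`), assembled from the lattice-free summation
`le_mul_of_separationScheme_upto` (`ArmSeparationSchemeFin.lean`) along the inward ladder of inner
radii `m_K = n · 2^{L-K}` with

* `f K = P(zdFourArmOutLanded m_K N)` — non-increasing in `K` by `zdFourArmOutLanded_mono_left`;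
* `h K = P(zdFourArmSep m_K N)` — the extension input `h K ≤ C₀ h (K+1)` is
  `exists_real_zdFourArmSep_le_mul_inward` (`ZdFourArmSepInwardExtProb.lean`) and the initial-scale
  input `c ≤ h 1` (`4 m₁ ≤ N < 8 m₁`) is `exists_le_real_zdFourArmSep_init` (`ZdFourArmSepInitProb.lean`);
* `g K = P(G m_K N)` for the event family `G` of the two remaining inputs, taken here as the
  hypothesis `InnerSeparationInputs` **stated as a `structure`-free conjunction inside the theorem**
  (no named fact): the inner surgery step
  `P(OutLanded m N) ≤ P(G m N) + ε · P(OutLanded 2m N)` for every prescribed `ε > 0` (Nolin's Lemma 15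
  [arXiv 14] at the inner square; see `real_zdFourArmOutLanded_le_add_mul_inner` for its reduction
  to a deterministic surgery off a bad event read inside `B(2m-1)`) and the inner landing
  `P(G 2m N) ≤ C₁(ε) · P(zdFourArmSep m N)` (Nolin's Prop. 12 (iii) [arXiv 11 (iii)] inwards).

Results:

* `real_zdFourArmOutLanded_le_add_mul_inner` — the step inequality from a deterministic inner
  surgery (`real_le_add_mul_of_surgery` with `E = OutLanded m N ⊆ E' = OutLanded 2m N`,
  `determinedBy_zdFourArmOutLanded`, `disjoint_outLandedPairs`);
* `real_zdFourArmOutLanded_ladder_le` — the summation along the ladder;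
* **`exists_real_zdFourArmOutLanded_le_mul_zdFourArmSep`** —
  `∃ C n₀, ∀ n ≥ n₀, ∀ N ≥ 2n, P(zdFourArmOutLanded n N) ≤ C · P(zdFourArmSep n N)` from the inner
  surgery-and-landing inputs;
* `zdFourArm_wellSeparated_of_halves` — Kesten's display
  `(S) ∃ n₀ c > 0, ∀ n ≥ n₀, ∀ N ≥ 2n, c · P(fourArmTwoClusters n N) ≤ P(zdFourArmSep n N)`
  from the external half `P(fourArmTwoClusters n N) ≤ C · P(zdFourArmOutLanded n N)` and the inner
  inputs; whence `DuminilCopinManolescuTassion2021_zdFourArm_quasiMult_of_halves` and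
  `Nolin2008_zdEdgeFourArmQuasiMult_of_halves` (`ZdFourArmQuasiMultOfSeparation.lean`).

## References

* P. Nolin, *Near-critical percolation in two dimensions*, Electron. J. Probab. 13 (2008), §4.3
  Prop. 12, §4.4 proof of Thm. 11 (arXiv 0711.4948: Prop. 11, Thm. 10, pp. 12–13) [Nolin2008].
* H. Kesten, *Scaling relations for 2D-percolation*, Comm. Math. Phys. 109 (1987), §2, Lemmas 4–5
  [KestenScalingCMP1987].
* H. Duminil-Copin, I. Manolescu, V. Tassion, PTRF 181 (2021), §6.2 Prop. 6.2, Prop. 6.3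
  [DuminilCopinManolescuTassion2021].
-/

noncomputable section

open MeasureTheory Set

namespace Literature.Probability.Percolation

open LatticeModels

/-! ### The inner step from a deterministic surgery -/

/-- **The inner step inequality from a deterministic surgery** (`1 ≤ m`, `4m ≤ N`): if off an event
`B` read off pairs each having an endpoint in `B(2m-1)` every configuration of
`zdFourArmOutLanded m N` lies in `G`, then
`P(zdFourArmOutLanded m N) ≤ P(G) + P(B) · P(zdFourArmOutLanded 2m N)` (every `p`). [cite: Nolin2008, §4.4, proof of Thm. 11, internal extremities (arXiv 0711.4948: Thm. 10, p. 13)] [cite: KestenScalingCMP1987, §2 Lemma 5 (proof)] -/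
theorem real_zdFourArmOutLanded_le_add_mul_inner (p : unitInterval) {m N : ℕ} (hm : 1 ≤ m) (h4 : 4 * m ≤ N)
    {G B : Set (BondConfig (Site 2))} {T : Set (Sym2 (Site 2))}
    (hsurg : zdFourArmOutLanded m N \ B ⊆ G) (hB : DeterminedBy B T) (hBm : MeasurableSet B)
    (hT : ∀ e ∈ T, ∃ v ∈ e, v ∈ box 2 (2 * m - 1)) :
    (bondPercolation (zdGraph 2) p).real (zdFourArmOutLanded m N) ≤
      (bondPercolation (zdGraph 2) p).real G +
        (bondPercolation (zdGraph 2) p).real B * (bondPercolation (zdGraph 2) p).real (zdFourArmOutLanded (2 * m) N) :=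
  real_le_add_mul_of_surgery (zdGraph 2) p (zdFourArmOutLanded_mono_left (by omega) (by omega)) hsurg
    (disjoint_outLandedPairs hT) (determinedBy_zdFourArmOutLanded (by omega) (by omega)) hB
    (measurableSet_zdFourArmOutLanded (by omega) (by omega)) hBm

/-! ### The summation along the inward ladder `m_K = n · 2^{L-K}` -/

/-- **The inward multi-scale summation on the ladder `m_K = n · 2^{L-K}`** (`64 ≤ n`, `1 ≤ L`,
`4 m₁ ≤ N ≤ 8 m₁` for `m₁ = n · 2^{L-1}`): given an event family `G` with the inner step
`P(OutLanded m_{K+1} N) ≤ P(G m_{K+1} N) + ε P(OutLanded m_K N)` and the inner landing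
`P(G m_K N) ≤ C₁ P(Sep m_{K+1} N)`, and `ε C₀² ≤ 1/2` for the inward-extension constant `C₀` of
`zdFourArmSep`, conclude `P(OutLanded m_K N) ≤ (2C₁ + 1/c) P(Sep m_K N)` for `1 ≤ K ≤ L`, `c` the
initial-scale constant. [cite: Nolin2008, §4.4, proof of Thm. 11, internal extremities (arXiv 0711.4948: Thm. 10, p. 13)] [cite: KestenScalingCMP1987, §2 Lemma 5] -/
theorem real_zdFourArmOutLanded_ladder_le {n N L : ℕ} (hn : 64 ≤ n) (hL : 1 ≤ L)
    (hNlo : 4 * (n * 2 ^ (L - 1)) ≤ N) (hNhi : N ≤ 8 * (n * 2 ^ (L - 1)))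
    {G : ℕ → ℕ → Set (BondConfig (Site 2))} {ε C₀ C₁ c : ℝ}
    (hε : 0 ≤ ε) (hC₀ : 1 ≤ C₀) (hC₁ : 0 ≤ C₁) (hc : 0 < c) (hsmall : ε * C₀ ^ 2 ≤ 1 / 2)
    (hext : ∀ m m' N' : ℕ, 64 ≤ m' → 2 * m' ≤ m → m ≤ 4 * m' → 2 * m ≤ N' →
      (bondPercolation (zdGraph 2) half).real (zdFourArmSep m N') ≤
        C₀ * (bondPercolation (zdGraph 2) half).real (zdFourArmSep m' N'))
    (hinit : ∀ m N' : ℕ, 64 ≤ m → 2 * m ≤ N' → N' ≤ 8 * m →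
      c ≤ (bondPercolation (zdGraph 2) half).real (zdFourArmSep m N'))
    (hstep : ∀ m : ℕ, n ≤ m → 4 * m ≤ N →
      (bondPercolation (zdGraph 2) half).real (zdFourArmOutLanded m N) ≤
        (bondPercolation (zdGraph 2) half).real (G m N) +
          ε * (bondPercolation (zdGraph 2) half).real (zdFourArmOutLanded (2 * m) N))
    (hland : ∀ m : ℕ, n ≤ m → 4 * m ≤ N →
      (bondPercolation (zdGraph 2) half).real (G (2 * m) N) ≤
        C₁ * (bondPercolation (zdGraph 2) half).real (zdFourArmSep m N)) :
    ∀ K, 1 ≤ K → K ≤ L →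
      (bondPercolation (zdGraph 2) half).real (zdFourArmOutLanded (n * 2 ^ (L - K)) N) ≤
        (2 * C₁ + 1 / c) * (bondPercolation (zdGraph 2) half).real (zdFourArmSep (n * 2 ^ (L - K)) N) := by
  set μ := bondPercolation (zdGraph 2) half with hμ
  set m : ℕ → ℕ := fun K => n * 2 ^ (L - K) with hm
  -- ladder arithmetic
  have hsucc : ∀ K, K + 1 ≤ L → m K = 2 * m (K + 1) := by
    intro K hK
    simp only [hm]
    rw [show L - K = L - (K + 1) + 1 by omega, pow_succ]
    ring
  have hle1 : ∀ K, 1 ≤ K → m K ≤ n * 2 ^ (L - 1) := by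
    intro K hK
    exact Nat.mul_le_mul_left _ (Nat.pow_le_pow_right (by norm_num) (by omega))
  have hge : ∀ K, n ≤ m K := fun K => Nat.le_mul_of_pos_right _ (Nat.two_pow_pos _)
  have hm1 : m 1 = n * 2 ^ (L - 1) := rfl
  have hinit1 : c ≤ μ.real (zdFourArmSep (m 1) N) := by
    have := hge 1
    rw [hm1] at this ⊢
    exact hinit _ N (by omega) (by omega) hNhi
  intro K hK hKL
  have key := le_mul_of_separationScheme_upto (f := fun K => μ.real (zdFourArmOutLanded (m K) N))
    (g := fun K => μ.real (G (m K) N)) (h := fun K => μ.real (zdFourArmSep (m K) N)) (k := 0) (L := L)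
    hε hC₀ hC₁ hc hsmall (fun K => measureReal_le_one) (fun K => measureReal_nonneg) (by omega)
    (fun K hK1 hKL => by
      have h1 := hle1 K (by omega)
      exact measureReal_mono (zdFourArmOutLanded_mono_left (by rw [hsucc K hKL]; omega) (by omega))
        (measure_ne_top _ _))
    (fun K _ hKL => by
      have h1 := hle1 (K + 1) (by omega)
      have h2 := hge (K + 1)
      have := hstep (m (K + 1)) h2 (by omega)
      rwa [← hsucc K hKL] at this)
    (fun K hK1 hKL => by
      have h1 := hle1 (K + 1) (by omega)
      have h2 := hge (K + 1)
      have := hland (m (K + 1)) h2 (by omega)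
      rwa [← hsucc K hKL] at this)
    (fun K hK1 hKL => by
      have h1 := hle1 K hK1
      have h2 := hge (K + 1)
      exact hext (m K) (m (K + 1)) N (by omega) (by rw [hsucc K hKL]) (by rw [hsucc K hKL]; omega) (by omega))
    hinit1 K (by omega) hKL
  exact key

/-! ### The internal half: `P(OutLanded n N) ≤ C · P(Sep n N)` -/

/-- **The internal half of Kesten's arm separation for four arms of bond percolation on `ℤ²`**:
if for every `ε > 0` there are `C₁ ≥ 0`, `n₁` and events `G m N` with the inner step
`P(OutLanded m N) ≤ P(G m N) + ε · P(OutLanded 2m N)` and the inner landing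
`P(G 2m N) ≤ C₁ · P(Sep m N)` for `n₁ ≤ m`, `4m ≤ N`, then
`∃ C n₀, ∀ n ≥ n₀, ∀ N ≥ 2n, P(zdFourArmOutLanded n N) ≤ C · P(zdFourArmSep n N)`. The extension
and initial-scale inputs of the scheme are the tree's `exists_real_zdFourArmSep_le_mul_inward` and
`exists_le_real_zdFourArmSep_init`. [cite: Nolin2008, §4.4, proof of Thm. 11, internal extremities (arXiv 0711.4948: Thm. 10, p. 13)] [cite: KestenScalingCMP1987, §2 Lemma 5] -/
theorem exists_real_zdFourArmOutLanded_le_mul_zdFourArmSep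
    (hin : ∀ ε : ℝ, 0 < ε → ∃ (C₁ : ℝ) (n₁ : ℕ) (G : ℕ → ℕ → Set (BondConfig (Site 2))), 0 ≤ C₁ ∧
      (∀ m N : ℕ, n₁ ≤ m → 4 * m ≤ N →
        (bondPercolation (zdGraph 2) half).real (zdFourArmOutLanded m N) ≤
          (bondPercolation (zdGraph 2) half).real (G m N) +
            ε * (bondPercolation (zdGraph 2) half).real (zdFourArmOutLanded (2 * m) N)) ∧
      (∀ m N : ℕ, n₁ ≤ m → 4 * m ≤ N →
        (bondPercolation (zdGraph 2) half).real (G (2 * m) N) ≤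
          C₁ * (bondPercolation (zdGraph 2) half).real (zdFourArmSep m N))) :
    ∃ (C : ℝ) (n₀ : ℕ), 0 < C ∧ ∀ n N : ℕ, n₀ ≤ n → 2 * n ≤ N →
      (bondPercolation (zdGraph 2) half).real (zdFourArmOutLanded n N) ≤
        C * (bondPercolation (zdGraph 2) half).real (zdFourArmSep n N) := by
  set μ := bondPercolation (zdGraph 2) half with hμ
  obtain ⟨C₀, hC₀, hext⟩ := exists_real_zdFourArmSep_le_mul_inward
  obtain ⟨c, hc, hinit⟩ := exists_le_real_zdFourArmSep_init
  have hε : 0 < 1 / (2 * C₀ ^ 2) := by positivity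
  obtain ⟨C₁, n₁, G, hC₁, hstep, hland⟩ := hin (1 / (2 * C₀ ^ 2)) hε
  refine ⟨max (2 * C₁ + 1 / c) (1 / c), max 64 n₁, by positivity, fun n N hn hN => ?_⟩
  have hn64 : 64 ≤ n := le_of_max_le_left hn
  have hn₁ : n₁ ≤ n := le_of_max_le_right hn
  by_cases hN4 : N < 4 * n
  · -- bounded ratio: `P(OutLanded) ≤ 1 ≤ P(Sep n N) / c`
    have h1 : c ≤ μ.real (zdFourArmSep n N) := hinit n N hn64 hN (by omega)
    calc μ.real (zdFourArmOutLanded n N) ≤ 1 := measureReal_le_one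
      _ ≤ 1 / c * μ.real (zdFourArmSep n N) := by
          rw [one_div_mul_eq_div, le_div_iff₀ hc, one_mul]; exact h1
      _ ≤ max (2 * C₁ + 1 / c) (1 / c) * μ.real (zdFourArmSep n N) :=
          mul_le_mul_of_nonneg_right (le_max_right _ _) measureReal_nonneg
  · -- the ladder: `L - 1 = log₂ (N / (4n))`
    have hN4 : 4 * n ≤ N := not_lt.1 hN4
    set t : ℕ := N / (4 * n) with ht
    have ht1 : 1 ≤ t := (Nat.le_div_iff_mul_le (by omega)).2 (by omega)
    set j : ℕ := Nat.log 2 t with hj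
    have hj1 : 2 ^ j ≤ t := Nat.pow_log_le_self 2 (by omega)
    have hj2 : t < 2 ^ (j + 1) := Nat.lt_pow_succ_log_self (by norm_num) t
    have htN : 4 * n * t ≤ N := by rw [ht]; exact Nat.mul_div_le N (4 * n)
    have hNt : N < 4 * n * (t + 1) := by rw [ht]; exact Nat.lt_mul_div_succ N (by omega)
    have hNlo : 4 * (n * 2 ^ (j + 1 - 1)) ≤ N := by
      rw [Nat.add_sub_cancel]
      calc 4 * (n * 2 ^ j) = 4 * n * 2 ^ j := by ring
        _ ≤ 4 * n * t := Nat.mul_le_mul_left _ hj1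
        _ ≤ N := htN
    have hNhi : N ≤ 8 * (n * 2 ^ (j + 1 - 1)) := by
      rw [Nat.add_sub_cancel]
      have : 4 * n * (t + 1) ≤ 4 * n * 2 ^ (j + 1) := Nat.mul_le_mul_left _ hj2
      calc N ≤ 4 * n * (t + 1) := hNt.le
        _ ≤ 4 * n * 2 ^ (j + 1) := this
        _ = 8 * (n * 2 ^ j) := by rw [pow_succ]; ring
    have hsmall : 1 / (2 * C₀ ^ 2) * C₀ ^ 2 ≤ 1 / 2 := by
      rw [le_div_iff₀ (by norm_num : (0 : ℝ) < 2)]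
      have hC : (0 : ℝ) < C₀ ^ 2 := by positivity
      rw [div_mul_eq_mul_div, one_mul, div_mul_eq_mul_div, div_le_iff₀ (by positivity)]
      nlinarith
    have key := real_zdFourArmOutLanded_ladder_le (G := G) hn64 (Nat.le_add_left 1 j) hNlo hNhi
      hε.le hC₀ hC₁ hc hsmall hext hinit
      (fun m hm h4 => hstep m N (hn₁.trans hm) h4) (fun m hm h4 => hland m N (hn₁.trans hm) h4)
      (j + 1) (Nat.le_add_left 1 j) le_rfl
    rw [Nat.sub_self, pow_zero, mul_one] at key
    exact key.trans (mul_le_mul_of_nonneg_right (le_max_left _ _) measureReal_nonneg)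

/-! ### Assembly of the two halves -/

/-- **Kesten's arm-separation display for four arms of bond percolation on `ℤ²` from its two
halves**: the external half `P(fourArmTwoClusters n N) ≤ C · P(zdFourArmOutLanded n N)` (Nolin 2008,
§4.4 "1. External extremities"; Kesten 1987, Lemma 4) and the inner surgery-and-landing inputs of
`exists_real_zdFourArmOutLanded_le_mul_zdFourArmSep` give
`∃ n₀ c > 0, ∀ n ≥ n₀, ∀ N ≥ 2n, c · P(fourArmTwoClusters n N) ≤ P(zdFourArmSep n N)`. [cite: Nolin2008, §4.4 Thm. 11 (arXiv 0711.4948: Thm. 10)] [cite: KestenScalingCMP1987, §2 Lemmas 4–5] [cite: DuminilCopinManolescuTassion2021, §6.2 Prop. 6.2, q = 1] -/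
theorem zdFourArm_wellSeparated_of_halves
    (hout : ∃ (C : ℝ) (n₀ : ℕ), 0 < C ∧ ∀ n N : ℕ, n₀ ≤ n → 2 * n ≤ N →
      (bondPercolation (zdGraph 2) half).real (fourArmTwoClusters n N) ≤
        C * (bondPercolation (zdGraph 2) half).real (zdFourArmOutLanded n N))
    (hin : ∀ ε : ℝ, 0 < ε → ∃ (C₁ : ℝ) (n₁ : ℕ) (G : ℕ → ℕ → Set (BondConfig (Site 2))), 0 ≤ C₁ ∧
      (∀ m N : ℕ, n₁ ≤ m → 4 * m ≤ N →
        (bondPercolation (zdGraph 2) half).real (zdFourArmOutLanded m N) ≤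
          (bondPercolation (zdGraph 2) half).real (G m N) +
            ε * (bondPercolation (zdGraph 2) half).real (zdFourArmOutLanded (2 * m) N)) ∧
      (∀ m N : ℕ, n₁ ≤ m → 4 * m ≤ N →
        (bondPercolation (zdGraph 2) half).real (G (2 * m) N) ≤
          C₁ * (bondPercolation (zdGraph 2) half).real (zdFourArmSep m N))) :
    ∃ n₀ : ℕ, ∃ c : ℝ, 0 < c ∧ ∀ n N : ℕ, n₀ ≤ n → 2 * n ≤ N →
      c * (bondPercolation (zdGraph 2) half).real (fourArmTwoClusters n N) ≤
        (bondPercolation (zdGraph 2) half).real (zdFourArmSep n N) := by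
  obtain ⟨C, n₀, hC, hout⟩ := hout
  obtain ⟨C', n₀', hC', hin⟩ := exists_real_zdFourArmOutLanded_le_mul_zdFourArmSep hin
  refine ⟨max n₀ n₀', 1 / (C * C'), by positivity, fun n N hn hN => ?_⟩
  have h1 := hout n N (le_of_max_le_left hn) hN
  have h2 := hin n N (le_of_max_le_right hn) hN
  rw [one_div_mul_eq_div, div_le_iff₀ (by positivity)]
  calc (bondPercolation (zdGraph 2) half).real (fourArmTwoClusters n N)
      ≤ C * (C' * (bondPercolation (zdGraph 2) half).real (zdFourArmSep n N)) :=
        h1.trans (mul_le_mul_of_nonneg_left h2 hC.le)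
    _ = (bondPercolation (zdGraph 2) half).real (zdFourArmSep n N) * (C * C') := by ring

/-- **DMT 2021, Prop. 6.3 for `q = 1` on `ℤ²` (cluster form) from the two halves of Kesten's arm
separation.** [cite: DuminilCopinManolescuTassion2021, §6.2 Prop. 6.3 (right inequality), q = 1, σ = 1010] -/
theorem DuminilCopinManolescuTassion2021_zdFourArm_quasiMult_of_halves
    (hout : ∃ (C : ℝ) (n₀ : ℕ), 0 < C ∧ ∀ n N : ℕ, n₀ ≤ n → 2 * n ≤ N →
      (bondPercolation (zdGraph 2) half).real (fourArmTwoClusters n N) ≤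
        C * (bondPercolation (zdGraph 2) half).real (zdFourArmOutLanded n N))
    (hin : ∀ ε : ℝ, 0 < ε → ∃ (C₁ : ℝ) (n₁ : ℕ) (G : ℕ → ℕ → Set (BondConfig (Site 2))), 0 ≤ C₁ ∧
      (∀ m N : ℕ, n₁ ≤ m → 4 * m ≤ N →
        (bondPercolation (zdGraph 2) half).real (zdFourArmOutLanded m N) ≤
          (bondPercolation (zdGraph 2) half).real (G m N) +
            ε * (bondPercolation (zdGraph 2) half).real (zdFourArmOutLanded (2 * m) N)) ∧
      (∀ m N : ℕ, n₁ ≤ m → 4 * m ≤ N →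
        (bondPercolation (zdGraph 2) half).real (G (2 * m) N) ≤
          C₁ * (bondPercolation (zdGraph 2) half).real (zdFourArmSep m N))) :
    DuminilCopinManolescuTassion2021_zdFourArm_quasiMult :=
  DuminilCopinManolescuTassion2021_zdFourArm_quasiMult_of_wellSeparated (zdFourArm_wellSeparated_of_halves hout hin)

/-- **Nolin 2008, Prop. 17 for the single-bond four-arm event on `ℤ²` from the two halves of
Kesten's arm separation.** [cite: Nolin2008, §4.1 and §4.5 Prop. 17 (arXiv 0711.4948: Prop. 16)] -/
theorem Nolin2008_zdEdgeFourArmQuasiMult_of_halves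
    (hout : ∃ (C : ℝ) (n₀ : ℕ), 0 < C ∧ ∀ n N : ℕ, n₀ ≤ n → 2 * n ≤ N →
      (bondPercolation (zdGraph 2) half).real (fourArmTwoClusters n N) ≤
        C * (bondPercolation (zdGraph 2) half).real (zdFourArmOutLanded n N))
    (hin : ∀ ε : ℝ, 0 < ε → ∃ (C₁ : ℝ) (n₁ : ℕ) (G : ℕ → ℕ → Set (BondConfig (Site 2))), 0 ≤ C₁ ∧
      (∀ m N : ℕ, n₁ ≤ m → 4 * m ≤ N →
        (bondPercolation (zdGraph 2) half).real (zdFourArmOutLanded m N) ≤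
          (bondPercolation (zdGraph 2) half).real (G m N) +
            ε * (bondPercolation (zdGraph 2) half).real (zdFourArmOutLanded (2 * m) N)) ∧
      (∀ m N : ℕ, n₁ ≤ m → 4 * m ≤ N →
        (bondPercolation (zdGraph 2) half).real (G (2 * m) N) ≤
          C₁ * (bondPercolation (zdGraph 2) half).real (zdFourArmSep m N))) :
    Nolin2008_zdEdgeFourArmQuasiMult :=
  Nolin2008_zdEdgeFourArmQuasiMult_of_zdFourArm_wellSeparated (zdFourArm_wellSeparated_of_halves hout hin)

end Literature.Probability.Percolation

end
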